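import Summits.KontsevichZagierPeriods.KontsevichZagierPeriods.Theses.TerasomaMultiplication
import Summits.KontsevichZagierPeriods.KontsevichZagierPeriods.Theses.TerasomaCovering
import Summits.KontsevichZagierPeriods.KontsevichZagierPeriods.Theses.MellinCoarea
import Literature.NumberTheory.Transcendental.KZMellinFibres
import Literature.NumberTheory.Transcendental.KZSubcalculusInvariants
import Literature.NumberTheory.Transcendental.KZDominatedFamilyRelations
import Literature.NumberTheory.Transcendental.KZLogCalculusProofs
import Literature.NumberTheory.Transcendental.KZSemialgebraicComplex

/-!
# `MultiplicationThree` (stmt-KontsevichZagierPeriods-3598) — line `bolza-involution-real-quotient`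
# (lead skeleton)

The crux (routes TerasomaMultiplication / TerasomaCovering / MellinCoarea, same text): for every
rational `s > 0` the box representation `[(0,1)², v₁^{-2/3}(1-v₁)^{s-1} v₂^{-1/3}(1-v₂)^{s-1}]` and the
simplex representation `[{σ₁,σ₂>0, σ₁+σ₂<3}, (σ₁σ₂(3-σ₁-σ₂))^{s-1}]` are `KZ.Equivalent`.

Line (idea card `Cruxes/MultiplicationThree/Ideas/bolza-involution-real-quotient.md`, = the route's
own lever (M3) of `Theses/TerasomaMultiplication.lean`, steps 0–(i) certified by the standing
disprover in `Cruxes/MultiplicationThree/Disproof.lean` §9, step (iii) in the promote-g2 form: Möbius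
2-torsion move + cyclic symmetry of the simplex). Rules (1a)(1b)(2) only, dimension 2, uniform in
`s` (the weight `u^{s-1}` rides in every integrand). Chain, with `f := u^{s−1}/√Q(a,u)`,
`Q(a,u) = a²(3−a)² − 4ua`, `g := (σ₁σ₂σ₃)^{s−1}`:

  box ~ [Σ_box, u^{s−1}(ψ+ψ̄)/2]                       (stub S1: shear + involution average)
      = [lowerCell] + [upperCell]  (null cut v = 1 − √u, rule 1a)
  [upperCell, ·] ~ [lowerCell, ·]                       (stub S3: the involution swaps the cells)
  [lowerCell, u^{s−1}(ψ+ψ̄)/2] ~ [Σ_neg, (3/2) f]        (stub S2: cube-root chart, HARDEST)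
  hence box ~ [Σ_neg, 3f] ~ 3·[Σ_neg, f]
  [Σ_neg, f] ~ [maxCellImage, f]                       (stub S4: Möbius 2-torsion translation)
  [M₃, g] ~ [maxCellImage, f]                          (stub S5: coarea shear on the max cell)
  Δ ~ [M₃, 3g] ~ 3·[M₃, g]                             (stub S6: cyclic symmetry of the simplex)

The six stubs are registered on the item (`ledger skeleton check`); `MultiplicationThree_of` is their
composition (this file, no `sorry` outside the stubs).
-/

noncomputable section

open Set MeasureTheory

namespace Summit.KontsevichZagierPeriods.TerasomaMultiplication.MultiplicationThreeBolza

open Literature.NumberTheory.Transcendental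
open Literature.NumberTheory.Transcendental.KZ
open Literature.ModelTheory.ExponentialFields (IsSemialgebraic)
open MvPolynomial (aeval X C)
open Summit.KontsevichZagierPeriods.KontsevichZagierPeriods.Theses.TerasomaMultiplication
  (MultiplicationThree)

/-! ## The six stubs (registered; each is proved in its own `Theorems/…Stub….lean` helper file) -/

/-- Stub S1 (steps 0 + (i): the coarea shear `Ψ(v₁,v₂) = ((1−v₁)(1−v₂), v₁)` of the box onto
`Σ_box = {0<u<1, 0<v<1−u}`, halving, the involution `ι(u,v) = (u,(1−u−v)/(1−v))` on one half,
re-addition — certified as move instances in `Cruxes/MultiplicationThree/Disproof.lean` §9): the pinned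
box representation is equivalent to `[Σ_box, u^{s−1}(ψ+ψ̄)/2]`, `ψ = v^{−2/3}(1−v)^{−2/3}(1−u−v)^{−1/3}`,
`ψ̄ = v^{−1/3}(1−v)^{−1/3}(1−u−v)^{−2/3}`, and such a representation exists. [folklore] -/
theorem stub_boxToSigmaBoxAvg :
    ∀ s : ℚ, 0 < s → ∀ (r : Literature.NumberTheory.Transcendental.KZ.IntegralRep 2), r.domain = {x | ∀ i, x i ∈ Set.Ioo (0:ℝ) 1} → Set.EqOn r.integrand (fun x => (x 0) ^ (-(2:ℝ)/3) * (1 - x 0) ^ ((s:ℝ) - 1) * (x 1) ^ (-(1:ℝ)/3) * (1 - x 1) ^ ((s:ℝ) - 1)) r.domain → (∃ ρ : Literature.NumberTheory.Transcendental.KZ.IntegralRep 2, ρ.domain = {x | 0 < x 0 ∧ 0 < x 1 ∧ x 1 < 1 - x 0} ∧ Set.EqOn ρ.integrand (fun x => ((x 0) ^ ((s:ℝ) - 1) * ((x 1) ^ (-(2:ℝ)/3) * (1 - x 1) ^ (-(2:ℝ)/3) * (1 - x 0 - x 1) ^ (-(1:ℝ)/3)) + (x 0) ^ ((s:ℝ)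 - 1) * ((x 1) ^ (-(1:ℝ)/3) * (1 - x 1) ^ (-(1:ℝ)/3) * (1 - x 0 - x 1) ^ (-(2:ℝ)/3))) / 2) ρ.domain) ∧ ∀ (ρ : Literature.NumberTheory.Transcendental.KZ.IntegralRep 2), ρ.domain = {x | 0 < x 0 ∧ 0 < x 1 ∧ x 1 < 1 - x 0} → Set.EqOn ρ.integrand (fun x => ((x 0) ^ ((s:ℝ) - 1) * ((x 1) ^ (-(2:ℝ)/3) * (1 - x 1) ^ (-(2:ℝ)/3) * (1 - x 0 - x 1) ^ (-(1:ℝ)/3)) + (x 0) ^ ((s:ℝ) - 1) * ((x 1) ^ (-(1:ℝ)/3) * (1 - x 1) ^ (-(1:ℝ)/3) * (1 - x 0 - x 1) ^ (-(2:ℝ)/3))) / 2) ρ.domain → Literature.NumberTheory.Transcendental.KZ.Equivalent r ρ := by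
  sorry

/-- Stub S2 (HARDEST — step (ii) on the lower cell `v < 1 − √u`, i.e. `u < (1−v)²`): the cube-root
chart `(u,v) ↦ (u, a)`, `a = −(z−1)²/z`, `z = (v(1−v)/(1−u−v))^{1/3}`, is injective on the cell with
image the negative branch `Σ_neg = {0<u<1, a<0}` and `|∂a/∂v|/√Q(a,u) = (ψ+ψ̄)/3` identically
(`MultiplicationThreeNegative.bolza_lever`, landed), so one rule-(2) move gives
`[lowerCell, u^{s−1}(ψ+ψ̄)/2] ~ [Σ_neg, (3/2)·u^{s−1}/√Q]`, and the latter representation exists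
(integrability transported through the chart). [folklore] -/
theorem stub_lowerCellToNegativeBranch :
    ∀ s : ℚ, 0 < s → ∀ (r : Literature.NumberTheory.Transcendental.KZ.IntegralRep 2), r.domain = {x | 0 < x 0 ∧ 0 < x 1 ∧ x 1 < 1 - x 0 ∧ x 0 < (1 - x 1) ^ 2} → Set.EqOn r.integrand (fun x => ((x 0) ^ ((s:ℝ) - 1) * ((x 1) ^ (-(2:ℝ)/3) * (1 - x 1) ^ (-(2:ℝ)/3) * (1 - x 0 - x 1) ^ (-(1:ℝ)/3)) + (x 0) ^ ((s:ℝ) - 1) * ((x 1) ^ (-(1:ℝ)/3) * (1 - x 1) ^ (-(1:ℝ)/3) * (1 - x 0 - x 1) ^ (-(2:ℝ)/3))) / 2) r.domain → (∃ ρ : Literature.NumberTheory.Transcendental.KZ.IntegralRep 2, ρ.domain = {x | 0 < x 0 ∧ x 0 < 1 ∧ x 1 < 0} ∧ Set.EqOn ρ.integrand (fun x => 3 / 2 * ((x 0) ^ ((s:ℝ) - 1) / Real.sqrt ((x 1) ^ 2 * (3 - x 1) ^ 2 - 4 * x 0 * x 1))) ρ.domain) ∧ ∀ (ρ : Literature.NumberTheory.Transcendental.KZ.IntegralRep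 2), ρ.domain = {x | 0 < x 0 ∧ x 0 < 1 ∧ x 1 < 0} → Set.EqOn ρ.integrand (fun x => 3 / 2 * ((x 0) ^ ((s:ℝ) - 1) / Real.sqrt ((x 1) ^ 2 * (3 - x 1) ^ 2 - 4 * x 0 * x 1))) ρ.domain → Literature.NumberTheory.Transcendental.KZ.Equivalent r ρ := by
  sorry

/-- Stub S3 (the involution swaps the two cells): `ι(u,v) = (u, (1−u−v)/(1−v))` maps the upper cell
`(1−v)² < u` of `Σ_box` bijectively onto the lower cell `u < (1−v)²` (its fixed curve is the cut
`v = 1 − √u`), with `|det Dι| = u/(1−v)²` and `(ψ+ψ̄)(ι x)·|det Dι(x)| = (ψ̄+ψ)(x)`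
(`MultiplicationThreeNegative.bolza_involution_density`, landed): one rule-(2) move
`[upperCell, u^{s−1}(ψ+ψ̄)/2] ~ [lowerCell, u^{s−1}(ψ+ψ̄)/2]`. [folklore] -/
theorem stub_upperCellToLowerCell :
    ∀ s : ℚ, 0 < s → ∀ (r ρ : Literature.NumberTheory.Transcendental.KZ.IntegralRep 2), r.domain = {x | 0 < x 0 ∧ 0 < x 1 ∧ x 1 < 1 - x 0 ∧ (1 - x 1) ^ 2 < x 0} → Set.EqOn r.integrand (fun x => ((x 0) ^ ((s:ℝ) - 1) * ((x 1) ^ (-(2:ℝ)/3) * (1 - x 1) ^ (-(2:ℝ)/3) * (1 - x 0 - x 1) ^ (-(1:ℝ)/3)) + (x 0) ^ ((s:ℝ) - 1) * ((x 1) ^ (-(1:ℝ)/3) * (1 - x 1) ^ (-(1:ℝ)/3) * (1 - x 0 - x 1) ^ (-(2:ℝ)/3))) / 2) r.domain → ρ.domain = {x | 0 < x 0 ∧ 0 < x 1 ∧ x 1 < 1 - x 0 ∧ x 0 < (1 - x 1) ^ 2} → Set.EqOn ρ.integrand (fun x => ((x 0) ^ ((s:ℝ) - 1) * ((x 1) ^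 (-(2:ℝ)/3) * (1 - x 1) ^ (-(2:ℝ)/3) * (1 - x 0 - x 1) ^ (-(1:ℝ)/3)) + (x 0) ^ ((s:ℝ) - 1) * ((x 1) ^ (-(1:ℝ)/3) * (1 - x 1) ^ (-(1:ℝ)/3) * (1 - x 0 - x 1) ^ (-(2:ℝ)/3))) / 2) ρ.domain → Literature.NumberTheory.Transcendental.KZ.Equivalent r ρ := by
  sorry

/-- Stub S4 (step (iii)a, the 2-torsion translation of `E_u : w² = Q(a,u)` as a Möbius map): with
`a₁(u) ∈ (0,1)` the root of `a(3−a)² = 4u`, `μ₁(a) = (3−a₁)(a−a₁)/(2a+a₁−3)` maps `(−∞,0)` onto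
`(a₁, b₁)`, `b₁ = (3−a₁)/2`, with `Q(μ₁a,u)(2a+a₁−3)⁴ = 9(3−a₁)²(a₁−1)²Q(a,u)`, hence
`|∂μ₁/∂a|/√Q(μ₁a,u) = 1/√Q(a,u)`: fibrewise over `u` (conveniently after the polynomial base change
`u = a₁(3−a₁)²/4`) this is a chain of rule-(2) moves `[Σ_neg, f] ~ [maxCellImage, f]`,
`f = u^{s−1}/√Q`, where `maxCellImage = {(u,a) | 0<a<3/2, 0<u, 4u<a(3−a)², (a ≤ 1 ∨ u < a²(3−2a))}
= {0<u<1, a₁(u) < a < b₁(u)}`; and the latter representation exists. [folklore] -/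
theorem stub_negativeBranchToMaxCellImage :
    ∀ s : ℚ, 0 < s → ∀ (r : Literature.NumberTheory.Transcendental.KZ.IntegralRep 2), r.domain = {x | 0 < x 0 ∧ x 0 < 1 ∧ x 1 < 0} → Set.EqOn r.integrand (fun x => (x 0) ^ ((s:ℝ) - 1) / Real.sqrt ((x 1) ^ 2 * (3 - x 1) ^ 2 - 4 * x 0 * x 1)) r.domain → (∃ ρ : Literature.NumberTheory.Transcendental.KZ.IntegralRep 2, ρ.domain = {x | 0 < x 0 ∧ 0 < x 1 ∧ 2 * x 1 < 3 ∧ 4 * x 0 < x 1 * (3 - x 1) ^ 2 ∧ (x 1 ≤ 1 ∨ x 0 < x 1 ^ 2 * (3 - 2 * x 1))} ∧ Set.EqOn ρ.integrand (fun x => (x 0) ^ ((s:ℝ) - 1) / Real.sqrt ((x 1) ^ 2 * (3 - x 1) ^ 2 - 4 * x 0 * x 1)) ρ.domain) ∧ ∀ (ρ : Literature.NumberTheory.Transcendental.KZ.IntegralRep 2), ρ.domain = {x | 0 < x 0 ∧ 0 < x 1 ∧ 2 * x 1 < 3 ∧ 4 * x 0 < x 1 * (3 - x 1) ^ 2 ∧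 (x 1 ≤ 1 ∨ x 0 < x 1 ^ 2 * (3 - 2 * x 1))} → Set.EqOn ρ.integrand (fun x => (x 0) ^ ((s:ℝ) - 1) / Real.sqrt ((x 1) ^ 2 * (3 - x 1) ^ 2 - 4 * x 0 * x 1)) ρ.domain → Literature.NumberTheory.Transcendental.KZ.Equivalent r ρ := by
  sorry

/-- Stub S5 (the simplex-side coarea shear on the max cell): `Θ(σ₁,σ₂) = (σ₁σ₂σ₃, σ₁)`,
`σ₃ = 3−σ₁−σ₂`, is injective on `M₃ = {σ₃ > σ₁, σ₃ > σ₂}` (inside the sheet `σ₂ < σ₃`) with image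
`maxCellImage` and `|det DΘ| = σ₁(σ₃−σ₂) = √Q(σ₁, σ₁σ₂σ₃)`, so one rule-(2) move gives
`[M₃, (σ₁σ₂σ₃)^{s−1}] ~ [maxCellImage, u^{s−1}/√Q(a,u)]` (coordinates `x 0 = u = σ₁σ₂σ₃`,
`x 1 = a = σ₁` on the right). [folklore] -/
theorem stub_maxCellToMaxCellImage :
    ∀ s : ℚ, 0 < s → ∀ (r ρ : Literature.NumberTheory.Transcendental.KZ.IntegralRep 2), r.domain = {x | 0 < x 0 ∧ 0 < x 1 ∧ x 0 < 3 - x 0 - x 1 ∧ x 1 < 3 - x 0 - x 1} → Set.EqOn r.integrand (fun x => (x 0 * x 1 * (3 - x 0 - x 1)) ^ ((s:ℝ) - 1)) r.domain → ρ.domain = {x | 0 < x 0 ∧ 0 < x 1 ∧ 2 * x 1 < 3 ∧ 4 * x 0 < x 1 * (3 - x 1) ^ 2 ∧ (x 1 ≤ 1 ∨ x 0 < x 1 ^ 2 * (3 - 2 * x 1))} → Set.EqOn ρ.integrand (fun x => (x 0) ^ ((s:ℝ) - 1) / Real.sqrt ((x 1) ^ 2 * (3 - x 1) ^ 2 - 4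 * x 0 * x 1)) ρ.domain → Literature.NumberTheory.Transcendental.KZ.Equivalent r ρ := by
  sorry

/-- Stub S6 (cyclic symmetry of the simplex = the text of route item `SimplexToMaxCell`,
stmt-KontsevichZagierPeriods-14676): `Δ = M₁ ∪ M₂ ∪ M₃ ∪ (null mirror segments)`, the cyclic
permutation `c(σ₁,σ₂) = (σ₂, 3−σ₁−σ₂)` (affine, `|det| = 1`, `g ∘ c = g`) maps `M₁` onto `M₃` and `c²`
maps `M₂` onto `M₃`: `[Δ, g] ~ [M₃, 3g]` by rules (1a), (2), (1b). [folklore] -/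
theorem stub_simplexToMaxCell :
    ∀ s : ℚ, 0 < s → ∀ (r r' : Literature.NumberTheory.Transcendental.KZ.IntegralRep 2), r.domain = {x | 0 < x 0 ∧ 0 < x 1 ∧ x 0 + x 1 < 3} → Set.EqOn r.integrand (fun x => (x 0 * x 1 * (3 - x 0 - x 1)) ^ ((s:ℝ) - 1)) r.domain → r'.domain = {x | 0 < x 0 ∧ 0 < x 1 ∧ x 0 < 3 - x 0 - x 1 ∧ x 1 < 3 - x 0 - x 1} → Set.EqOn r'.integrand (fun x => 3 * (x 0 * x 1 * (3 - x 0 - x 1)) ^ ((s:ℝ) - 1)) r'.domain → Literature.NumberTheory.Transcendental.KZ.Equivalent r r' := by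
  sorry

/-! ## Glue: vocabulary, null cut, bookkeeping -/

/-- The lower cell `{0<u, 0<v, v<1−u, u<(1−v)²}` of `Σ_box`. [folklore] -/
def lowerCell : Set (Fin 2 → ℝ) := {x | 0 < x 0 ∧ 0 < x 1 ∧ x 1 < 1 - x 0 ∧ x 0 < (1 - x 1) ^ 2}

/-- The upper cell `{0<u, 0<v, v<1−u, (1−v)²<u}` of `Σ_box`. [folklore] -/
def upperCell : Set (Fin 2 → ℝ) := {x | 0 < x 0 ∧ 0 < x 1 ∧ x 1 < 1 - x 0 ∧ (1 - x 1) ^ 2 < x 0}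

/-- The max cell `M₃ = {σ₃ > σ₁, σ₃ > σ₂}` of the simplex. [folklore] -/
def maxCell : Set (Fin 2 → ℝ) := {x | 0 < x 0 ∧ 0 < x 1 ∧ x 0 < 3 - x 0 - x 1 ∧ x 1 < 3 - x 0 - x 1}

/-- Defining polynomials of the lower cell. [folklore] -/
def lowerCellPolys : Fin 4 → MvPolynomial (Fin 2) ℚ := ![X 0, X 1, 1 - X 0 - X 1, (1 - X 1) ^ 2 - X 0]

/-- Defining polynomials of the upper cell. [folklore] -/
def upperCellPolys : Fin 4 → MvPolynomial (Fin 2) ℚ := ![X 0, X 1, 1 - X 0 - X 1, X 0 - (1 - X 1) ^ 2]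

/-- Defining polynomials of the max cell. [folklore] -/
def maxCellPolys : Fin 4 → MvPolynomial (Fin 2) ℚ := ![X 0, X 1, 3 - 2 * X 0 - X 1, 3 - X 0 - 2 * X 1]

/-- `aeval` of the numeral `3`. [folklore] -/
theorem aeval_three (x : Fin 2 → ℝ) : aeval x (3 : MvPolynomial (Fin 2) ℚ) = (3 : ℝ) := by
  rw [show (3 : MvPolynomial (Fin 2) ℚ) = C 3 by simp [map_ofNat], MvPolynomial.aeval_C]; simp

/-- `aeval` of the numeral `2`. [folklore] -/
theorem aeval_two (x : Fin 2 → ℝ) : aeval x (2 : MvPolynomial (Fin 2) ℚ) = (2 : ℝ) := by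
  rw [show (2 : MvPolynomial (Fin 2) ℚ) = C 2 by simp [map_ofNat], MvPolynomial.aeval_C]; simp

/-- The lower cell is `ℚ`-semialgebraic. [folklore] -/
theorem isSemialgebraic_lowerCell : IsSemialgebraic ℚ lowerCell := by
  convert isSemialgebraic_setOf_forall_aeval_pos lowerCellPolys using 1
  ext x
  simp only [lowerCell, mem_setOf_eq, Fin.forall_fin_succ, lowerCellPolys, Matrix.cons_val_zero,
    Matrix.cons_val_succ, map_sub, map_one, map_pow, MvPolynomial.aeval_X, IsEmpty.forall_iff, and_true]
  constructor
  · rintro ⟨h0, h1, h2, h3⟩; exact ⟨h0, h1, by linarith, by linarith⟩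
  · rintro ⟨h0, h1, h2, h3⟩; exact ⟨h0, h1, by linarith, by linarith⟩

/-- The upper cell is `ℚ`-semialgebraic. [folklore] -/
theorem isSemialgebraic_upperCell : IsSemialgebraic ℚ upperCell := by
  convert isSemialgebraic_setOf_forall_aeval_pos upperCellPolys using 1
  ext x
  simp only [upperCell, mem_setOf_eq, Fin.forall_fin_succ, upperCellPolys, Matrix.cons_val_zero,
    Matrix.cons_val_succ, map_sub, map_one, map_pow, MvPolynomial.aeval_X, IsEmpty.forall_iff, and_true]
  constructor
  · rintro ⟨h0, h1, h2, h3⟩; exact ⟨h0, h1, by linarith, by linarith⟩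
  · rintro ⟨h0, h1, h2, h3⟩; exact ⟨h0, h1, by linarith, by linarith⟩

/-- The max cell is `ℚ`-semialgebraic. [folklore] -/
theorem isSemialgebraic_maxCell : IsSemialgebraic ℚ maxCell := by
  convert isSemialgebraic_setOf_forall_aeval_pos maxCellPolys using 1
  ext x
  simp only [maxCell, mem_setOf_eq, Fin.forall_fin_succ, maxCellPolys, Matrix.cons_val_zero,
    Matrix.cons_val_succ, map_sub, map_mul, MvPolynomial.aeval_X, IsEmpty.forall_iff, and_true,
    aeval_three, aeval_two]
  constructor
  · rintro ⟨h0, h1, h2, h3⟩; exact ⟨h0, h1, by linarith, by linarith⟩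
  · rintro ⟨h0, h1, h2, h3⟩; exact ⟨h0, h1, by linarith, by linarith⟩

/-- The two cells are disjoint. [folklore] -/
theorem lowerCell_inter_upperCell : lowerCell ∩ upperCell = ∅ := by
  ext x
  simp only [lowerCell, upperCell, mem_inter_iff, mem_setOf_eq, mem_empty_iff_false, iff_false]
  rintro ⟨⟨-, -, -, h⟩, ⟨-, -, -, h'⟩⟩
  linarith

/-- `Σ_box` minus the two cells lies on the cut `v = 1 − √u`, the graph of a semialgebraic function
of the base. [folklore] -/
theorem sigmaBox_diff_cells_subset :
    {x : Fin 2 → ℝ | 0 < x 0 ∧ 0 < x 1 ∧ x 1 < 1 - x 0} \ (lowerCell ∪ upperCell) ⊆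
      {z : Fin (1 + 1) → ℝ | Fin.init z ∈ (univ : Set (Fin 1 → ℝ)) ∧
        z (Fin.last 1) = (fun w : Fin 1 → ℝ => 1 - Real.sqrt (w 0)) (Fin.init z)} := by
  rintro x ⟨⟨h0, h1, h2⟩, hx⟩
  simp only [mem_union, not_or, lowerCell, upperCell, mem_setOf_eq, not_and, not_lt] at hx
  obtain ⟨hlo, hhi⟩ := hx
  have a := hlo h0 h1 h2
  have b := hhi h0 h1 h2
  have heq : x 0 = (1 - x 1) ^ 2 := le_antisymm b a
  refine ⟨mem_univ _, ?_⟩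
  change x 1 = 1 - Real.sqrt (x 0)
  rw [heq, Real.sqrt_sq (by linarith)]
  ring

/-- The cut is null. [folklore] -/
theorem volume_sigmaBox_diff_cells :
    volume ({x : Fin 2 → ℝ | 0 < x 0 ∧ 0 < x 1 ∧ x 1 < 1 - x 0} \ (lowerCell ∪ upperCell)) = 0 := by
  have hu : IsSemialgebraicFunOn ℚ (univ : Set (Fin 1 → ℝ)) (fun w : Fin 1 → ℝ => 1 - Real.sqrt (w 0)) := by
    have h1 : IsSemialgebraicFunOn ℚ (univ : Set (Fin 1 → ℝ)) (fun _ => (1:ℝ)) :=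
      (isSemialgebraicFunOn_aeval Literature.ModelTheory.ExponentialFields.isSemialgebraic_univ
        (1 : MvPolynomial (Fin 1) ℚ)).congr fun x _ => by simp
    exact IsSemialgebraicFunOn.sub_holds h1 isSemialgebraicFunOn_sqrt_univ
  exact measure_mono_null sigmaBox_diff_cells_subset (volume_graph_eq_zero hu)

/-- `(2/3 : ℝ)` and `3` are algebraic (bookkeeping constants). [folklore] -/
theorem isAlgebraic_twoThirds : IsAlgebraic ℚ ((2/3 : ℚ) : ℝ) := isAlgebraic_algebraMap _

/-! ## The composition -/

/-- **The line closes the crux** (composition of the six stubs). With `R₁ = [Σ_box, u^{s−1}(ψ+ψ̄)/2]`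
(S1), split `R₁` along the null cut into its two cells (rule 1a); push the lower cell to
`R₂ = [Σ_neg, (3/2)f]` (S2) and the upper cell to the lower cell (S3), so `[box] ~ 2[R₂] ~ [Σ_neg, 3f]
~ 3[N]`, `N = [Σ_neg, f] = (2/3)·R₂`; then `N ~ [maxCellImage, f] ~ [M₃, g]` (S4, S5) and
`[Δ] ~ [M₃, 3g] ~ 3[M₃, g]` (S6, rule 1b). [folklore] -/
theorem MultiplicationThree_of : MultiplicationThree := by
  intro s hs r r' hr hri hr' hri'
  -- S1: the averaged sheared box representation
  obtain ⟨⟨R₁, hR₁d, hR₁i⟩, hS1⟩ := stub_boxToSigmaBoxAvg s hs r hr hri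
  have e1 : Equivalent r R₁ := hS1 R₁ hR₁d hR₁i
  -- the two cells of Σ_box
  have hAsub : lowerCell ⊆ R₁.domain := by
    rw [hR₁d]; rintro x ⟨h0, h1, h2, -⟩; exact ⟨h0, h1, h2⟩
  have hBsub : upperCell ⊆ R₁.domain := by
    rw [hR₁d]; rintro x ⟨h0, h1, h2, -⟩; exact ⟨h0, h1, h2⟩
  set A := R₁.restrict lowerCell isSemialgebraic_lowerCell hAsub with hA
  set B := R₁.restrict upperCell isSemialgebraic_upperCell hBsub with hB
  have hE : IsSemialgebraic ℚ (lowerCell ∪ upperCell) :=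
    isSemialgebraic_lowerCell.union isSemialgebraic_upperCell
  have hEsub : lowerCell ∪ upperCell ⊆ R₁.domain := union_subset hAsub hBsub
  -- (1a) cut out the null curve, then split
  have c1 : of R₁ - of (R₁.restrict _ hE hEsub) ∈ relations :=
    KZ.IntegralRep.of_sub_of_restrict_mem_relations _ hE hEsub
      (by rw [hR₁d]; exact volume_sigmaBox_diff_cells)
  have c2 : of (R₁.restrict _ hE hEsub) - of A - of B ∈ relations := by
    refine domainAddRel_subset_relations ⟨2, R₁.restrict _ hE hEsub, A, B, rfl, ?_,
      fun _ _ => rfl, fun _ _ => rfl, rfl⟩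
    simp [hA, hB, lowerCell_inter_upperCell]
  -- S2 on the lower cell
  have hAi : EqOn A.integrand _ A.domain := fun x hx => hR₁i (hAsub hx)
  obtain ⟨⟨R₂, hR₂d, hR₂i⟩, hS2⟩ := stub_lowerCellToNegativeBranch s hs A rfl hAi
  have e2 : Equivalent A R₂ := hS2 R₂ hR₂d hR₂i
  -- S3: the upper cell is equivalent to the lower cell
  have hBi : EqOn B.integrand _ B.domain := fun x hx => hR₁i (hBsub hx)
  have e3 : Equivalent B A := stub_upperCellToLowerCell s hs B A rfl hBi rfl hAi
  -- N = [Σ_neg, f] := (2/3) · R₂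
  set N := R₂.constMul ((2/3 : ℚ) : ℝ) isAlgebraic_twoThirds with hN
  have hNd : N.domain = {x | 0 < x 0 ∧ x 0 < 1 ∧ x 1 < 0} := by rw [hN, IntegralRep.domain_constMul, hR₂d]
  have hNi : EqOn N.integrand (fun x => (x 0) ^ ((s:ℝ) - 1) /
      Real.sqrt ((x 1) ^ 2 * (3 - x 1) ^ 2 - 4 * x 0 * x 1)) N.domain := by
    intro x hx
    rw [hN, IntegralRep.integrand_constMul]
    simp only
    rw [hR₂i (by simpa [hN] using hx)]
    push_cast
    ring
  -- [R₂.constMul 2] ~ [N.constMul 3]: same domain, both integrands are 3f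
  have c3 : of (R₂.constMul ((2:ℕ):ℝ) (isAlgebraic_nat 2)) -
      of (N.constMul ((3:ℕ):ℝ) (isAlgebraic_nat 3)) ∈ relations := by
    refine of_sub_of_mem_relations_of_eqOn (by simp [hN]) fun x hx => ?_
    simp only [IntegralRep.integrand_constMul, hN]
    simp only [IntegralRep.domain_constMul] at hx
    rw [hR₂i hx]
    push_cast
    ring
  have c4 := R₂.of_constMul_nat_sub_nsmul_mem_relations 2
  have c5 := N.of_constMul_nat_sub_nsmul_mem_relations 3
  -- S4, S5: N ~ [maxCellImage, f] ~ M := r' restricted to the max cell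
  obtain ⟨⟨R₄, hR₄d, hR₄i⟩, hS4⟩ := stub_negativeBranchToMaxCellImage s hs N hNd hNi
  have e4 : Equivalent N R₄ := hS4 R₄ hR₄d hR₄i
  have hMsub : maxCell ⊆ r'.domain := by
    rw [hr']; rintro x ⟨h0, h1, h2, -⟩; exact ⟨h0, h1, by linarith⟩
  set M := r'.restrict maxCell isSemialgebraic_maxCell hMsub with hM
  have hMi : EqOn M.integrand (fun x => (x 0 * x 1 * (3 - x 0 - x 1)) ^ ((s:ℝ) - 1)) M.domain :=
    fun x hx => hri' (hMsub hx)
  have e5 : Equivalent M R₄ := stub_maxCellToMaxCellImage s hs M R₄ rfl hMi hR₄d hR₄i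
  -- S6: r' ~ [M₃, 3g] = M.constMul 3
  have e6 : Equivalent r' (M.constMul ((3:ℕ):ℝ) (isAlgebraic_nat 3)) := by
    refine stub_simplexToMaxCell s hs r' _ hr' hri' rfl fun x hx => ?_
    simp only [IntegralRep.integrand_constMul]
    rw [hMi hx]
    push_cast
    ring
  have c6 := M.of_constMul_nat_sub_nsmul_mem_relations 3
  -- bookkeeping in FormalRep ⧸ relations
  have eNM : of N - of M ∈ relations := e4.trans e5.symm
  have e3NM : (3 : ℕ) • (of N - of M) ∈ relations := relations.nsmul_mem eNM 3
  show of r - of r' ∈ relations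
  have key : of r - of r' =
      (of r - of R₁) + (of R₁ - of (R₁.restrict _ hE hEsub)) +
      (of (R₁.restrict _ hE hEsub) - of A - of B) + (of B - of A) + 2 • (of A - of R₂) -
      (of (R₂.constMul ((2:ℕ):ℝ) (isAlgebraic_nat 2)) - 2 • of R₂) +
      (of (R₂.constMul ((2:ℕ):ℝ) (isAlgebraic_nat 2)) - of (N.constMul ((3:ℕ):ℝ) (isAlgebraic_nat 3))) +
      (of (N.constMul ((3:ℕ):ℝ) (isAlgebraic_nat 3)) - 3 • of N) +
      (3 : ℕ) • (of N - of M) -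
      (of (M.constMul ((3:ℕ):ℝ) (isAlgebraic_nat 3)) - 3 • of M) -
      (of r' - of (M.constMul ((3:ℕ):ℝ) (isAlgebraic_nat 3))) := by
    simp only [smul_sub]
    abel
  rw [key]
  refine relations.sub_mem (relations.sub_mem (relations.add_mem (relations.add_mem
    (relations.add_mem (relations.sub_mem (relations.add_mem (relations.add_mem (relations.add_mem
    (relations.add_mem e1 c1) c2) e3) (relations.nsmul_mem e2 2)) c4) c3) c5) e3NM) c6) e6

/-- The crux of route TerasomaMultiplication, by name. [folklore] -/
theorem MultiplicationThree_proof :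
    Summit.KontsevichZagierPeriods.KontsevichZagierPeriods.Theses.TerasomaMultiplication.MultiplicationThree :=
  MultiplicationThree_of

/-- The same decl of route TerasomaCovering (identical text). [folklore] -/
theorem MultiplicationThree_proof_covering :
    Summit.KontsevichZagierPeriods.KontsevichZagierPeriods.Theses.TerasomaCovering.MultiplicationThree :=
  MultiplicationThree_of

/-- The same decl of route MellinCoarea (identical text). [folklore] -/
theorem MultiplicationThree_proof_mellin :
    Summit.KontsevichZagierPeriods.KontsevichZagierPeriods.Theses.MellinCoarea.MultiplicationThree :=
  MultiplicationThree_of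

end Summit.KontsevichZagierPeriods.TerasomaMultiplication.MultiplicationThreeBolza

end
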